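import Literature.NumberTheory.Automorphic.HarishChandraLeviIntegralReal
import Literature.NumberTheory.Automorphic.ArchimedeanGLn
import Literature.NumberTheory.Automorphic.RealCasimirGL
import HarnessLib

/-!
# `Z(𝔪)` integral over `Z(𝔤)` modulo `U·𝔲`: transport to `𝔤𝔩_n(K_∞)`, place by place

Topic `NumberTheory/Automorphic`; sequel of `HarishChandraLeviIntegralReal`. The Lie algebra acting
on automorphic forms on `GL_n(𝔸_K)` is `𝔤_∞ = 𝔤𝔩_n(K_∞)`, `K_∞ = K ⊗_ℚ ℝ = mixedSpace K =
∏_{w real} ℝ × ∏_{w complex} ℂ` (`AdelicGLnGlue.archGroupGL`, whose Lie algebra is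
`⊤ ≤ Matrix (Fin n) (Fin n) (mixedSpace K)`), and its factors `𝔤𝔩_n(K_w)` embed by
`realPlaceLie`, `complexPlaceLie` (`ArchimedeanGLn`, entrywise `realPlaceHom w : ℝ →ₙₐ[ℝ] K_∞`,
`complexPlaceHom w : ℂ →ₙₐ[ℝ] K_∞`). This file transports the integrality relations of
`HarishChandraLeviIntegralReal` (for `𝔤𝔩_{k+l}(ℝ)` and `𝔤𝔩_{k+l}(ℂ)`) along such coefficient maps:

* `mapU f m : U(𝔤𝔩_m(A)) →ₐ[ℝ] U(𝔤𝔩_m(B))` for a non-unital real algebra map `f : A →ₙₐ[ℝ] B` of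
  commutative coefficient algebras (entrywise on `𝔤𝔩_m`); it is compatible with the block maps
  `jLeftR`, `jRightR` (`mapU_jLeftR`, `mapU_jRightR`) and maps the left ideal `U·𝔲` and the right
  ideal `𝔲·U` over `A` into those over `B` (`mapU_mem_uIdealR`, `mapU_mem_uRightR`).
* `mapU_mem_center` — **if `B = f(A) ⊕ C` with `f(A)·C = 0`** (hypothesis `horth`: every `b ∈ B` is
  `f a` plus an element killed by `f(A)`; e.g. a factor of a product of algebras), **then `mapU f`
  maps the centre of `U(𝔤𝔩_m(A))` into the centre of `U(𝔤𝔩_m(B))`** (the other factors commute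
  with `𝔤𝔩_m(f(A))`).
* `exists_monic_mem_uRightR_mapU`, `exists_monic_mem_uIdealR_mapU` — transport of monic relations
  with central coefficients modulo `𝔲·U`, resp. `U·𝔲`.
* `realPlaceHom_orth`, `complexPlaceHom_orth` — the factors `K_w ⊆ K_∞` satisfy `horth`; whence
  **the headline statements** `exists_monic_mem_uRightR_realPlace_jLeftR` (and `…_jRightR`,
  `…_complexPlace_…`): for every central `z ∈ Z(U(𝔤𝔩_k(K_w)))`, its image in `U(𝔤𝔩_{k+l}(K_∞))`
  (first Levi block at the place `w`) satisfies a monic polynomial with coefficients in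
  `Z(U(𝔤𝔩_{k+l}(K_∞)))` modulo the right ideal `𝔲·U` generated by the upper right block — the
  algebraic input that makes constant terms of `Z(𝔤_∞)`-finite functions on `GL_{k+l}(𝔸_K)` along
  `P_k` finite under `Z(𝔤𝔩_k(K_w))`, `Z(𝔤𝔩_l(K_w))` for every archimedean place `w`
  (Moeglin–Waldspurger 1995, I.2.17; Borel–Jacquet 1979, 4.3–4.4).
* `topEnvEquiv` — `U(↥(⊤ : LieSubalgebra R L)) ≃ₐ[R] U(L)`, to pass to the enveloping algebra of
  `(RealMatrixGroup.gl A N).lie = ⊤` used by `ArchimedeanCalculus` (`centerU`, `IsCentralWord`) and by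
  `HarishChandraGLParameterOfCharacter` (whose `lift_realPlaceLie_mem_center` is the `U(↥⊤)`-valued
  form of `mapU_realPlace_mem_center` below).

Everything here is proved: definitions and theorems only, no named fact.

## References

* C. Moeglin, J.-L. Waldspurger, *Spectral decomposition and Eisenstein series* (1995), I.2.17
  [MoeglinWaldspurger1995].
* A. Borel, H. Jacquet, *Automorphic forms and automorphic representations* (1979), 4.3–4.4
  [BorelJacquet1979].
* L. Clozel, *Motifs et formes automorphes* (1990), §3.3 (the factors `𝔤𝔩_n(K_w)` of `𝔤_∞`)
  [Clozel1990].
-/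

noncomputable section

-- Mathlib idiom (Mathlib/Algebra/Lie/OfAssociative.lean): commutator brackets on associative algebras
attribute [local instance 100] LieRing.ofAssociativeRing

open UniversalEnvelopingAlgebra

namespace Literature.NumberTheory.Automorphic.HCLevi

/-! ### `U(⊤) ≃ U(L)` -/

section TopEquiv

variable (R : Type*) [CommRing R] (L : Type*) [LieRing L] [LieAlgebra R L]

/-- **`U(↥⊤) ≃ U(L)`**: the enveloping algebra of the top Lie subalgebra is that of `L` (functoriality
of `U` along `LieSubalgebra.topEquiv`). Used to pass between `U(Matrix (Fin n) (Fin n) K_∞)` and the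
enveloping algebra of `(RealMatrixGroup.gl K_∞ (Fin n)).lie = ⊤` of `ArchimedeanCalculus`. [folklore] -/
def topEnvEquiv : UniversalEnvelopingAlgebra R (⊤ : LieSubalgebra R L) ≃ₐ[R] UniversalEnvelopingAlgebra R L :=
  AlgEquiv.ofAlgHom
    (UniversalEnvelopingAlgebra.lift R ((ι R).comp (LieSubalgebra.topEquiv : (⊤ : LieSubalgebra R L) ≃ₗ⁅R⁆ L).toLieHom))
    (UniversalEnvelopingAlgebra.lift R ((ι R).comp (LieSubalgebra.topEquiv : (⊤ : LieSubalgebra R L) ≃ₗ⁅R⁆ L).symm.toLieHom))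
    (by
      refine UniversalEnvelopingAlgebra.hom_ext (h := LieHom.ext fun X ↦ ?_)
      simp only [LieHom.coe_comp, Function.comp_apply, AlgHom.coe_toLieHom, AlgHom.coe_comp, lift_ι_apply,
        LieEquiv.coe_toLieHom, LieEquiv.apply_symm_apply, AlgHom.coe_id, id_eq])
    (by
      refine UniversalEnvelopingAlgebra.hom_ext (h := LieHom.ext fun X ↦ ?_)
      simp only [LieHom.coe_comp, Function.comp_apply, AlgHom.coe_toLieHom, AlgHom.coe_comp, lift_ι_apply,
        LieEquiv.coe_toLieHom, LieEquiv.symm_apply_apply, AlgHom.coe_id, id_eq])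

/-- `topEnvEquiv (ι x) = ι x`. [folklore] -/
@[simp]
theorem topEnvEquiv_ι (x : (⊤ : LieSubalgebra R L)) : topEnvEquiv R L (ι R x) = ι R (x : L) := by
  rw [topEnvEquiv, AlgEquiv.ofAlgHom_apply, lift_ι_apply]
  rfl

/-- `topEnvEquiv.symm (ι X) = ι ⟨X, _⟩`. [folklore] -/
@[simp]
theorem topEnvEquiv_symm_ι (X : L) :
    (topEnvEquiv R L).symm (ι R X) = ι R (⟨X, trivial⟩ : (⊤ : LieSubalgebra R L)) := by
  rw [topEnvEquiv, AlgEquiv.ofAlgHom_symm_apply, lift_ι_apply]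
  rfl

/-- `topEnvEquiv` maps the centre onto the centre. [folklore] -/
theorem topEnvEquiv_mem_center_iff (u : UniversalEnvelopingAlgebra R (⊤ : LieSubalgebra R L)) :
    topEnvEquiv R L u ∈ Subalgebra.center R (UniversalEnvelopingAlgebra R L) ↔
      u ∈ Subalgebra.center R (UniversalEnvelopingAlgebra R (⊤ : LieSubalgebra R L)) := by
  constructor
  · intro h
    rw [Subalgebra.mem_center_iff]
    intro b
    apply (topEnvEquiv R L).injective
    rw [map_mul, map_mul, Subalgebra.mem_center_iff.mp h]
  · intro h
    rw [Subalgebra.mem_center_iff]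
    intro b
    obtain ⟨b, rfl⟩ := (topEnvEquiv R L).surjective b
    rw [← map_mul, ← map_mul, Subalgebra.mem_center_iff.mp h]

end TopEquiv

/-! ### Change of coefficients `mapU f` -/

section MapU

variable {A B : Type*} [CommRing A] [Algebra ℝ A] [CommRing B] [Algebra ℝ B] (f : A →ₙₐ[ℝ] B)

/-- The real algebra map `U(𝔤𝔩_m(A)) → U(𝔤𝔩_m(B))` induced entrywise by a non-unital algebra map
`f : A → B` of coefficient algebras (`mapMatrixLie f` of `ArchimedeanGLn`). [folklore] -/
def mapU (m : ℕ) : UniversalEnvelopingAlgebra ℝ (Matrix (Fin m) (Fin m) A) →ₐ[ℝ]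
    UniversalEnvelopingAlgebra ℝ (Matrix (Fin m) (Fin m) B) :=
  UniversalEnvelopingAlgebra.lift ℝ ((ι ℝ).comp (mapMatrixLie (N := Fin m) f))

variable {f} {m k l : ℕ}

/-- `mapU` on generators. [folklore] -/
@[simp]
theorem mapU_ι (X : Matrix (Fin m) (Fin m) A) : mapU f m (ι ℝ X) = ι ℝ (X.map f) :=
  lift_ι_apply ℝ _ X

/-- Entrywise maps commute with the first block embedding. [folklore] -/
theorem map_inclLeftR (X : Matrix (Fin k) (Fin k) A) :
    (inclLeftR k l X).map f = inclLeftR k l (X.map f) := by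
  ext i j
  rw [Matrix.map_apply, inclLeftR_apply, inclLeftR_apply]
  induction i using Fin.addCases with
  | left a =>
    induction j using Fin.addCases with
    | left b => rw [blockDiag'_castAdd_castAdd, blockDiag'_castAdd_castAdd, Matrix.map_apply]
    | right b => rw [blockDiag'_castAdd_natAdd, blockDiag'_castAdd_natAdd, map_zero]
  | right a =>
    induction j using Fin.addCases with
    | left b => rw [blockDiag'_natAdd_castAdd, blockDiag'_natAdd_castAdd, map_zero]
    | right b => rw [blockDiag'_natAdd_natAdd, blockDiag'_natAdd_natAdd, Matrix.zero_apply, Matrix.zero_apply, map_zero]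

/-- Entrywise maps commute with the second block embedding. [folklore] -/
theorem map_inclRightR (Y : Matrix (Fin l) (Fin l) A) :
    (inclRightR k l Y).map f = inclRightR k l (Y.map f) := by
  ext i j
  rw [Matrix.map_apply, inclRightR_apply, inclRightR_apply]
  induction i using Fin.addCases with
  | left a =>
    induction j using Fin.addCases with
    | left b => rw [blockDiag'_castAdd_castAdd, blockDiag'_castAdd_castAdd, Matrix.zero_apply, Matrix.zero_apply, map_zero]
    | right b => rw [blockDiag'_castAdd_natAdd, blockDiag'_castAdd_natAdd, map_zero]
  | right a =>
    induction j using Fin.addCases with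
    | left b => rw [blockDiag'_natAdd_castAdd, blockDiag'_natAdd_castAdd, map_zero]
    | right b => rw [blockDiag'_natAdd_natAdd, blockDiag'_natAdd_natAdd, Matrix.map_apply]

/-- **`mapU` commutes with `jLeftR`.** [folklore] -/
theorem mapU_jLeftR (u : UniversalEnvelopingAlgebra ℝ (Matrix (Fin k) (Fin k) A)) :
    mapU f (k + l) (jLeftR k l u) = jLeftR k l (mapU f k u) := by
  have h : (mapU f (k + l)).comp (jLeftR (𝕜 := A) k l) = (jLeftR (𝕜 := B) k l).comp (mapU f k) := by
    refine UniversalEnvelopingAlgebra.hom_ext (h := LieHom.ext fun X ↦ ?_)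
    simp only [LieHom.coe_comp, Function.comp_apply, AlgHom.coe_toLieHom, AlgHom.coe_comp, jLeftR_ι, mapU_ι,
      map_inclLeftR]
  exact congr($h u)

/-- **`mapU` commutes with `jRightR`.** [folklore] -/
theorem mapU_jRightR (u : UniversalEnvelopingAlgebra ℝ (Matrix (Fin l) (Fin l) A)) :
    mapU f (k + l) (jRightR k l u) = jRightR k l (mapU f l u) := by
  have h : (mapU f (k + l)).comp (jRightR (𝕜 := A) k l) = (jRightR (𝕜 := B) k l).comp (mapU f l) := by
    refine UniversalEnvelopingAlgebra.hom_ext (h := LieHom.ext fun X ↦ ?_)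
    simp only [LieHom.coe_comp, Function.comp_apply, AlgHom.coe_toLieHom, AlgHom.coe_comp, jRightR_ι, mapU_ι,
      map_inclRightR]
  exact congr($h u)

/-- Entrywise maps preserve the upper right block. [folklore] -/
theorem map_mem_uBlockR {X : Matrix (Fin (k + l)) (Fin (k + l)) A} (hX : X ∈ uBlockR (𝕜 := A) k l) :
    X.map f ∈ uBlockR (𝕜 := B) k l := by
  intro a b h
  rw [Matrix.map_apply, hX a b h, map_zero]

/-- **`mapU` maps `U·𝔲` over `A` into `U·𝔲` over `B`.** [folklore] -/
theorem mapU_mem_uIdealR {w : UniversalEnvelopingAlgebra ℝ (Matrix (Fin (k + l)) (Fin (k + l)) A)}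
    (hw : w ∈ uIdealR (𝕜 := A) k l) : mapU f (k + l) w ∈ uIdealR (𝕜 := B) k l := by
  induction hw using Submodule.span_induction with
  | mem x hx =>
    obtain ⟨X, hX, rfl⟩ := hx
    rw [mapU_ι]
    exact ι_mem_uIdealR (map_mem_uBlockR hX)
  | zero => rw [map_zero]; exact Ideal.zero_mem _
  | add x y _ _ hx hy => rw [map_add]; exact Ideal.add_mem _ hx hy
  | smul c x _ hx => rw [smul_eq_mul, map_mul]; exact Ideal.mul_mem_left _ _ hx

/-- **`mapU` maps `𝔲·U` over `A` into `𝔲·U` over `B`.** [folklore] -/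
theorem mapU_mem_uRightR {w : UniversalEnvelopingAlgebra ℝ (Matrix (Fin (k + l)) (Fin (k + l)) A)}
    (hw : w ∈ uRightR (𝕜 := A) k l) : mapU f (k + l) w ∈ uRightR (𝕜 := B) k l := by
  induction hw using Submodule.span_induction with
  | mem x hx =>
    obtain ⟨X, hX, a, rfl⟩ := hx
    rw [map_mul, mapU_ι]
    exact Submodule.subset_span ⟨X.map f, map_mem_uBlockR hX, _, rfl⟩
  | zero => rw [map_zero]; exact Submodule.zero_mem _
  | add x y _ _ hx hy => rw [map_add]; exact Submodule.add_mem _ hx hy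
  | smul c x _ hx => rw [map_smul]; exact Submodule.smul_mem _ c hx

/-- Matrices with entries killed by `f(A)` commute with the image of `𝔤𝔩_m(A)`. [folklore] -/
theorem lie_map_eq_zero_of_forall_mul_eq_zero {R' : Matrix (Fin m) (Fin m) B}
    (hR : ∀ (a : A) (i j : Fin m), f a * R' i j = 0) (X : Matrix (Fin m) (Fin m) A) :
    ⁅X.map f, R'⁆ = 0 := by
  have h1 : X.map f * R' = 0 := by
    ext i j
    rw [Matrix.mul_apply, Matrix.zero_apply]
    exact Finset.sum_eq_zero fun c _ ↦ by rw [Matrix.map_apply, hR]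
  have h2 : R' * X.map f = 0 := by
    ext i j
    rw [Matrix.mul_apply, Matrix.zero_apply]
    exact Finset.sum_eq_zero fun c _ ↦ by rw [Matrix.map_apply, mul_comm, hR]
  rw [LieRing.of_associative_ring_bracket, h1, h2, sub_zero]

/-- **`mapU f` maps the centre into the centre** when `B = f(A) ⊕ C` with `f(A)·C = 0` (every
`b ∈ B` is `f a + c` with `f(A) c = 0`): the elements of `𝔤𝔩_m(C)` commute with the image of
`U(𝔤𝔩_m(A))`, and `𝔤𝔩_m(B) = 𝔤𝔩_m(f A) + 𝔤𝔩_m(C)`. [folklore] -/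
theorem mapU_mem_center (horth : ∀ b : B, ∃ a : A, ∀ a' : A, f a' * (b - f a) = 0)
    {z : UniversalEnvelopingAlgebra ℝ (Matrix (Fin m) (Fin m) A)}
    (hz : z ∈ Subalgebra.center ℝ (UniversalEnvelopingAlgebra ℝ (Matrix (Fin m) (Fin m) A))) :
    mapU f m z ∈ Subalgebra.center ℝ (UniversalEnvelopingAlgebra ℝ (Matrix (Fin m) (Fin m) B)) := by
  refine mem_center_of_forall_ι_comm fun Y ↦ ?_
  choose g hg using horth
  -- decompose `Y = X.map f + R'` with `f(A) R' = 0` entrywise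
  set X : Matrix (Fin m) (Fin m) A := Matrix.of fun i j ↦ g (Y i j) with hX
  set R' : Matrix (Fin m) (Fin m) B := Y - X.map f with hR'
  have hR : ∀ (a : A) (i j : Fin m), f a * R' i j = 0 := fun a i j ↦ by
    rw [hR', Matrix.sub_apply, Matrix.map_apply, hX, Matrix.of_apply, hg]
  have hY : Y = X.map f + R' := by rw [hR', add_sub_cancel]
  -- `ι R'` commutes with every `mapU f u`
  have hcomm : ∀ u, ι ℝ R' * mapU f m u = mapU f m u * ι ℝ R' := by
    intro u
    induction u using Literature.Algebra.Lie.UEnv.induction_on with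
    | algebraMap r => rw [AlgHom.commutes]; exact (Algebra.commutes r (ι ℝ R')).symm
    | ι_mem X' =>
      rw [mapU_ι, ← sub_eq_zero, ← LieRing.of_associative_ring_bracket, ← LieHom.map_lie, ← lie_skew,
        lie_map_eq_zero_of_forall_mul_eq_zero hR, neg_zero, map_zero]
    | mul a b ha hb => rw [map_mul, ← mul_assoc, ha, mul_assoc, hb, mul_assoc]
    | add a b ha hb => rw [map_add, mul_add, add_mul, ha, hb]
  rw [hY, map_add, add_mul, mul_add, hcomm z, ← mapU_ι, ← map_mul, ← map_mul, Subalgebra.mem_center_iff.mp hz]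

/-- **Transport of a monic relation modulo the right ideal `𝔲·U`** along `mapU f`: the
coefficients of the transported relation are the images `mapU f (c_i)` of the original central
coefficients (central in `U(𝔤𝔩_{k+l}(B))` under `horth`, `mapU_mem_center`). [folklore] -/
theorem exists_monic_mem_uRightR_mapU
    {u : UniversalEnvelopingAlgebra ℝ (Matrix (Fin (k + l)) (Fin (k + l)) A)}
    (h : ∃ (d : ℕ) (c : ℕ → UniversalEnvelopingAlgebra ℝ (Matrix (Fin (k + l)) (Fin (k + l)) A)),
      (∀ i, c i ∈ Subalgebra.center ℝ (UniversalEnvelopingAlgebra ℝ (Matrix (Fin (k + l)) (Fin (k + l)) A))) ∧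
        u ^ d + ∑ i ∈ Finset.range d, c i * u ^ i ∈ uRightR (𝕜 := A) k l) :
    ∃ (d : ℕ) (c : ℕ → UniversalEnvelopingAlgebra ℝ (Matrix (Fin (k + l)) (Fin (k + l)) A)),
      (∀ i, c i ∈ Subalgebra.center ℝ (UniversalEnvelopingAlgebra ℝ (Matrix (Fin (k + l)) (Fin (k + l)) A))) ∧
        mapU f (k + l) u ^ d + ∑ i ∈ Finset.range d, mapU f (k + l) (c i) * mapU f (k + l) u ^ i ∈
          uRightR (𝕜 := B) k l := by
  obtain ⟨d, c, hc, hmem⟩ := h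
  refine ⟨d, c, hc, ?_⟩
  have h1 := mapU_mem_uRightR (f := f) hmem
  simpa only [map_add, map_pow, map_sum, map_mul] using h1

/-- **Transport of a monic relation modulo the left ideal `U·𝔲`** along `mapU f`. [folklore] -/
theorem exists_monic_mem_uIdealR_mapU
    {u : UniversalEnvelopingAlgebra ℝ (Matrix (Fin (k + l)) (Fin (k + l)) A)}
    (h : ∃ (d : ℕ) (c : ℕ → UniversalEnvelopingAlgebra ℝ (Matrix (Fin (k + l)) (Fin (k + l)) A)),
      (∀ i, c i ∈ Subalgebra.center ℝ (UniversalEnvelopingAlgebra ℝ (Matrix (Fin (k + l)) (Fin (k + l)) A))) ∧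
        u ^ d + ∑ i ∈ Finset.range d, c i * u ^ i ∈ uIdealR (𝕜 := A) k l) :
    ∃ (d : ℕ) (c : ℕ → UniversalEnvelopingAlgebra ℝ (Matrix (Fin (k + l)) (Fin (k + l)) A)),
      (∀ i, c i ∈ Subalgebra.center ℝ (UniversalEnvelopingAlgebra ℝ (Matrix (Fin (k + l)) (Fin (k + l)) A))) ∧
        mapU f (k + l) u ^ d + ∑ i ∈ Finset.range d, mapU f (k + l) (c i) * mapU f (k + l) u ^ i ∈
          uIdealR (𝕜 := B) k l := by
  obtain ⟨d, c, hc, hmem⟩ := h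
  refine ⟨d, c, hc, ?_⟩
  have h1 := mapU_mem_uIdealR (f := f) hmem
  simpa only [map_add, map_pow, map_sum, map_mul] using h1

end MapU

/-! ### The factors `K_w ⊆ K_∞` -/

section Places

open NumberField NumberField.InfinitePlace NumberField.mixedEmbedding

variable {K : Type*} [Field K]

/-- The real factor `K_w = ℝ ⊆ K_∞` is complemented by an ideal killed by it. [folklore] -/
theorem realPlaceHom_orth (w : {w : InfinitePlace K // IsReal w}) (b : mixedSpace K) :
    ∃ a : ℝ, ∀ a' : ℝ, realPlaceHom w a' * (b - realPlaceHom w a) = 0 := by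
  classical
  refine ⟨b.1 w, fun a' ↦ ?_⟩
  rw [realPlaceHom_apply, realPlaceHom_apply]
  refine Prod.ext (funext fun v ↦ ?_) (by simp)
  simp only [Prod.fst_mul, Prod.fst_sub, Pi.mul_apply, Pi.sub_apply, Prod.fst_zero, Pi.zero_apply, Pi.single_apply]
  split_ifs with h
  · subst h; ring
  · rw [zero_mul]

/-- The complex factor `K_w = ℂ ⊆ K_∞` is complemented by an ideal killed by it. [folklore] -/
theorem complexPlaceHom_orth (w : {w : InfinitePlace K // IsComplex w}) (b : mixedSpace K) :
    ∃ a : ℂ, ∀ a' : ℂ, complexPlaceHom w a' * (b - complexPlaceHom w a) = 0 := by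
  classical
  refine ⟨b.2 w, fun a' ↦ ?_⟩
  rw [complexPlaceHom_apply, complexPlaceHom_apply]
  refine Prod.ext (by simp) (funext fun v ↦ ?_)
  simp only [Prod.snd_mul, Prod.snd_sub, Pi.mul_apply, Pi.sub_apply, Prod.snd_zero, Pi.zero_apply, Pi.single_apply]
  split_ifs with h
  · subst h; ring
  · rw [zero_mul]

/-- At a real place, `mapU` maps the centre of `U(𝔤𝔩_m(ℝ))` into the centre of `U(𝔤𝔩_m(K_∞))`
(the coefficients of the relations above are central); an instance of the generic `mapU_mem_center`.
The same fact in the `U(↥⊤)`-valued formulation (`lift (ι ∘ toTop ∘ realPlaceLie)`, i.e. after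
`topEnvEquiv.symm`) is `lift_realPlaceLie_mem_center` of `HarishChandraGLParameterOfCharacter`
(not imported here: its import closure is the archimedean parameter theory). [folklore] -/
theorem mapU_realPlace_mem_center (w : {w : InfinitePlace K // IsReal w}) {m : ℕ}
    {z : UniversalEnvelopingAlgebra ℝ (Matrix (Fin m) (Fin m) ℝ)}
    (hz : z ∈ Subalgebra.center ℝ (UniversalEnvelopingAlgebra ℝ (Matrix (Fin m) (Fin m) ℝ))) :
    mapU (realPlaceHom w) m z ∈ Subalgebra.center ℝ (UniversalEnvelopingAlgebra ℝ (Matrix (Fin m) (Fin m) (mixedSpace K))) :=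
  mapU_mem_center (realPlaceHom_orth w) hz

/-- At a complex place, `mapU` maps the centre of `U(𝔤𝔩_m(ℂ))` into the centre of
`U(𝔤𝔩_m(K_∞))`; cf. `lift_complexPlaceLie_mem_center` of `HarishChandraGLParameterOfCharacter` for
the `U(↥⊤)`-valued formulation. [folklore] -/
theorem mapU_complexPlace_mem_center (w : {w : InfinitePlace K // IsComplex w}) {m : ℕ}
    {z : UniversalEnvelopingAlgebra ℝ (Matrix (Fin m) (Fin m) ℂ)}
    (hz : z ∈ Subalgebra.center ℝ (UniversalEnvelopingAlgebra ℝ (Matrix (Fin m) (Fin m) ℂ))) :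
    mapU (complexPlaceHom w) m z ∈ Subalgebra.center ℝ (UniversalEnvelopingAlgebra ℝ (Matrix (Fin m) (Fin m) (mixedSpace K))) :=
  mapU_mem_center (complexPlaceHom_orth w) hz

variable (k l : ℕ)

/-- **Integrality at a real place, first block, right ideal form.** For a real place `w` of `K` and
a central `z ∈ Z(U(𝔤𝔩_k(ℝ)))`, the image of `z` in `U(𝔤𝔩_{k+l}(K_∞))` (first Levi block at `w`)
satisfies a monic polynomial modulo the right ideal `𝔲·U` of the upper right block, whose coefficients
are the images at `w` of central elements of `U(𝔤𝔩_{k+l}(ℝ))` (central in `U(𝔤𝔩_{k+l}(K_∞))` by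
`mapU_realPlace_mem_center`). Moeglin–Waldspurger 1995, I.2.17 (`𝔷^M` finitely generated over
`i(𝔷)`), transported to `𝔤_∞ = ∏_w 𝔤𝔩_{k+l}(K_w)`. [cite: MoeglinWaldspurger1995, I.2.17] -/
theorem exists_monic_mem_uRightR_realPlace_jLeftR (w : {w : InfinitePlace K // IsReal w})
    (z : UniversalEnvelopingAlgebra ℝ (Matrix (Fin k) (Fin k) ℝ))
    (hz : z ∈ Subalgebra.center ℝ (UniversalEnvelopingAlgebra ℝ (Matrix (Fin k) (Fin k) ℝ))) :
    ∃ (d : ℕ) (c : ℕ → UniversalEnvelopingAlgebra ℝ (Matrix (Fin (k + l)) (Fin (k + l)) ℝ)),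
      (∀ i, c i ∈ Subalgebra.center ℝ (UniversalEnvelopingAlgebra ℝ (Matrix (Fin (k + l)) (Fin (k + l)) ℝ))) ∧
        jLeftR k l (mapU (realPlaceHom w) k z) ^ d +
          ∑ i ∈ Finset.range d, mapU (realPlaceHom w) (k + l) (c i) * jLeftR k l (mapU (realPlaceHom w) k z) ^ i ∈
            uRightR (𝕜 := mixedSpace K) k l := by
  rw [← mapU_jLeftR]
  exact exists_monic_mem_uRightR_mapU (exists_monic_mem_uRightR_jLeftR z hz)

/-- **Integrality at a real place, second block, right ideal form.** [cite: MoeglinWaldspurger1995, I.2.17] -/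
theorem exists_monic_mem_uRightR_realPlace_jRightR (w : {w : InfinitePlace K // IsReal w})
    (z : UniversalEnvelopingAlgebra ℝ (Matrix (Fin l) (Fin l) ℝ))
    (hz : z ∈ Subalgebra.center ℝ (UniversalEnvelopingAlgebra ℝ (Matrix (Fin l) (Fin l) ℝ))) :
    ∃ (d : ℕ) (c : ℕ → UniversalEnvelopingAlgebra ℝ (Matrix (Fin (k + l)) (Fin (k + l)) ℝ)),
      (∀ i, c i ∈ Subalgebra.center ℝ (UniversalEnvelopingAlgebra ℝ (Matrix (Fin (k + l)) (Fin (k + l)) ℝ))) ∧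
        jRightR k l (mapU (realPlaceHom w) l z) ^ d +
          ∑ i ∈ Finset.range d, mapU (realPlaceHom w) (k + l) (c i) * jRightR k l (mapU (realPlaceHom w) l z) ^ i ∈
            uRightR (𝕜 := mixedSpace K) k l := by
  rw [← mapU_jRightR]
  exact exists_monic_mem_uRightR_mapU (exists_monic_mem_uRightR_jRightR z hz)

/-- **Integrality at a complex place, first block, right ideal form.** [cite: MoeglinWaldspurger1995, I.2.17] -/
theorem exists_monic_mem_uRightR_complexPlace_jLeftR (w : {w : InfinitePlace K // IsComplex w})
    (z : UniversalEnvelopingAlgebra ℝ (Matrix (Fin k) (Fin k) ℂ))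
    (hz : z ∈ Subalgebra.center ℝ (UniversalEnvelopingAlgebra ℝ (Matrix (Fin k) (Fin k) ℂ))) :
    ∃ (d : ℕ) (c : ℕ → UniversalEnvelopingAlgebra ℝ (Matrix (Fin (k + l)) (Fin (k + l)) ℂ)),
      (∀ i, c i ∈ Subalgebra.center ℝ (UniversalEnvelopingAlgebra ℝ (Matrix (Fin (k + l)) (Fin (k + l)) ℂ))) ∧
        jLeftR k l (mapU (complexPlaceHom w) k z) ^ d +
          ∑ i ∈ Finset.range d, mapU (complexPlaceHom w) (k + l) (c i) * jLeftR k l (mapU (complexPlaceHom w) k z) ^ i ∈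
            uRightR (𝕜 := mixedSpace K) k l := by
  rw [← mapU_jLeftR]
  exact exists_monic_mem_uRightR_mapU (exists_monic_mem_uRightR_jLeftR z hz)

/-- **Integrality at a complex place, second block, right ideal form.** [cite: MoeglinWaldspurger1995, I.2.17] -/
theorem exists_monic_mem_uRightR_complexPlace_jRightR (w : {w : InfinitePlace K // IsComplex w})
    (z : UniversalEnvelopingAlgebra ℝ (Matrix (Fin l) (Fin l) ℂ))
    (hz : z ∈ Subalgebra.center ℝ (UniversalEnvelopingAlgebra ℝ (Matrix (Fin l) (Fin l) ℂ))) :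
    ∃ (d : ℕ) (c : ℕ → UniversalEnvelopingAlgebra ℝ (Matrix (Fin (k + l)) (Fin (k + l)) ℂ)),
      (∀ i, c i ∈ Subalgebra.center ℝ (UniversalEnvelopingAlgebra ℝ (Matrix (Fin (k + l)) (Fin (k + l)) ℂ))) ∧
        jRightR k l (mapU (complexPlaceHom w) l z) ^ d +
          ∑ i ∈ Finset.range d, mapU (complexPlaceHom w) (k + l) (c i) * jRightR k l (mapU (complexPlaceHom w) l z) ^ i ∈
            uRightR (𝕜 := mixedSpace K) k l := by
  rw [← mapU_jRightR]
  exact exists_monic_mem_uRightR_mapU (exists_monic_mem_uRightR_jRightR z hz)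

/-- **Integrality at a real place, first block, left ideal form** (`U·𝔲`, for left-invariant
operators / left translations as in Moeglin–Waldspurger I.2.17). [cite: MoeglinWaldspurger1995, I.2.17] -/
theorem exists_monic_mem_uIdealR_realPlace_jLeftR (w : {w : InfinitePlace K // IsReal w})
    (z : UniversalEnvelopingAlgebra ℝ (Matrix (Fin k) (Fin k) ℝ))
    (hz : z ∈ Subalgebra.center ℝ (UniversalEnvelopingAlgebra ℝ (Matrix (Fin k) (Fin k) ℝ))) :
    ∃ (d : ℕ) (c : ℕ → UniversalEnvelopingAlgebra ℝ (Matrix (Fin (k + l)) (Fin (k + l)) ℝ)),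
      (∀ i, c i ∈ Subalgebra.center ℝ (UniversalEnvelopingAlgebra ℝ (Matrix (Fin (k + l)) (Fin (k + l)) ℝ))) ∧
        jLeftR k l (mapU (realPlaceHom w) k z) ^ d +
          ∑ i ∈ Finset.range d, mapU (realPlaceHom w) (k + l) (c i) * jLeftR k l (mapU (realPlaceHom w) k z) ^ i ∈
            uIdealR (𝕜 := mixedSpace K) k l := by
  rw [← mapU_jLeftR]
  exact exists_monic_mem_uIdealR_mapU (exists_monic_mem_uIdealR_jLeftR z hz)

/-- **Integrality at a complex place, first block, left ideal form.** [cite: MoeglinWaldspurger1995, I.2.17] -/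
theorem exists_monic_mem_uIdealR_complexPlace_jLeftR (w : {w : InfinitePlace K // IsComplex w})
    (z : UniversalEnvelopingAlgebra ℝ (Matrix (Fin k) (Fin k) ℂ))
    (hz : z ∈ Subalgebra.center ℝ (UniversalEnvelopingAlgebra ℝ (Matrix (Fin k) (Fin k) ℂ))) :
    ∃ (d : ℕ) (c : ℕ → UniversalEnvelopingAlgebra ℝ (Matrix (Fin (k + l)) (Fin (k + l)) ℂ)),
      (∀ i, c i ∈ Subalgebra.center ℝ (UniversalEnvelopingAlgebra ℝ (Matrix (Fin (k + l)) (Fin (k + l)) ℂ))) ∧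
        jLeftR k l (mapU (complexPlaceHom w) k z) ^ d +
          ∑ i ∈ Finset.range d, mapU (complexPlaceHom w) (k + l) (c i) * jLeftR k l (mapU (complexPlaceHom w) k z) ^ i ∈
            uIdealR (𝕜 := mixedSpace K) k l := by
  rw [← mapU_jLeftR]
  exact exists_monic_mem_uIdealR_mapU (exists_monic_mem_uIdealR_jLeftR z hz)

end Places

end Literature.NumberTheory.Automorphic.HCLevi
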